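import Literature.RingTheory.PolynomialMaps.NumericToSymbolic
import Literature.RingTheory.PolynomialMaps.NumericToSymbolicHensel
import HarnessLib

/-!
# Numeric-to-symbolic transfer, III: Proposition 3.4 and Theorem 1.21
(Garg–Makam–Oliveira–Wigderson 2019), proved

* `exists_powerSeries_transfer` — **Proposition 3.4** of [GargMakamOliveiraWigderson2019],
  PROVED, in relation-transfer form: for finitely many `b₁, …, b_r ∈ K̄`,
  `K = F(z_σ)`, `F` algebraically closed of characteristic zero, there are `c ∈ F^σ` and power
  series `p₁, …, p_r ∈ F⟦X_σ⟧` such that every polynomial relation `G(z, b) = 0` (coefficients in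
  `F`) remains true after `z ↦ X + c`, `b ↦ p`. By the first isomorphism theorem this is exactly
  the printed statement: an `F`-algebra homomorphism `F[z, b₁, …, b_r] → F⟦z - c⟧` extending
  `F[z] ↪ F⟦z - c⟧` (in the variable `X = z - c`).
* `numericToSymbolic` — **Theorem 1.21** (the transfer), PROVED: `im(L) ⊆ im(M)` implies
  `L(X + c) = M(p₁, …, p_r)` for some `c` and power series `pⱼ` (from Prop. 3.3,
  `exists_generic_solution`, and Prop. 3.4, as in §4 "Proof of Theorem 1.21").

## Proof of Proposition 3.4 (elementary replacement of §4.2)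

With the ingredients of `NumericToSymbolicHensel.lean`: all `bⱼ ∈ K(θ)`, `θ` integral over
`A = F[z]` with minimal polynomial `P`; `bⱼ = Qⱼ(θ)/S` with a common denominator `0 ≠ S ∈ A`;
`U P + V P' = D ≠ 0`. Pick `c` with `D(c) S(c) ≠ 0` and a power-series root `Θ` of `P(X + c, ·)`
(Hensel). Let `B = A[1/S]`, mapped to `K̄` over `A` and to `F⟦X⟧` over `shift c` (`S(X + c)` is a
unit). A relation `G(z, b) = 0` gives `G̃ = G(z, q) ∈ B[X]`, `qⱼ = Qⱼ/S`, with `G̃(θ) = 0`, hence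
`G̃(Θ) = 0` (`eval₂_eq_zero_of_isLocalization`), i.e. `G(X + c, p) = 0` for `pⱼ = qⱼ(X + c, Θ)`.

## References

* [GargMakamOliveiraWigderson2019] A. Garg, V. Makam, R. Oliveira, A. Wigderson, *More barriers for
  rank methods, via a "numeric to symbolic" transfer*, FOCS 2019, arXiv:1904.04299; Prop. 3.4
  (§3.2, proof §4.2), Thm. 1.21 (§1.5, proof §4).
-/

noncomputable section

namespace Literature.RingTheory.PolynomialMaps

open scoped Polynomial IntermediateField

variable {F : Type*} [Field F] {σ : Type*}

/-- **Garg–Makam–Oliveira–Wigderson 2019, Proposition 3.4 (power series for algebraic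
functions), proved — relation-transfer form.** Let `F` be algebraically closed of characteristic
zero, `σ` and `τ` finite, and `b : τ → K̄` finitely many elements of the algebraic closure of
`K = F(z_σ)`. Then there are `c ∈ F^σ` and power series `p : τ → F⟦X_σ⟧` such that for every
`G ∈ F[z_σ, y_τ]` with `G(z, b) = 0` in `K̄` one has `G(X + c, p) = 0` in `F⟦X_σ⟧`; equivalently,
`z ↦ X + c`, `bⱼ ↦ pⱼ` is an `F`-algebra homomorphism `F[z, b] → F⟦X⟧ = F⟦z - c⟧` extending the
inclusion of `F[z]`. [cite: GargMakamOliveiraWigderson2019, Prop. 3.4] -/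
theorem exists_powerSeries_transfer [IsAlgClosed F] [CharZero F] [Finite σ] {τ : Type*}
    [Finite τ] (b : τ → (AlgebraicClosure (FractionRing (MvPolynomial σ F)))) :
    ∃ (c : σ → F) (p : τ → (MvPowerSeries σ F)), ∀ G : MvPolynomial (σ ⊕ τ) F,
      MvPolynomial.aeval (Sum.elim (fun v => algebraMap (MvPolynomial σ F)
        (AlgebraicClosure (FractionRing (MvPolynomial σ F))) (MvPolynomial.X v)) b) G = 0 →
      MvPolynomial.aeval
        (Sum.elim (fun v => (MvPowerSeries.X v + MvPowerSeries.C (c v) : MvPowerSeries σ F)) p)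
          G = 0 := by
  classical
  haveI : Fintype τ := Fintype.ofFinite τ
  -- a primitive element `θ`, integral over `A`, and representations `Q j (θ) = s j • b j`
  obtain ⟨θ, hθ, hbθ⟩ := exists_integral_primitive_element (F := F) b
  choose Q s hs hQ using fun j => exists_polynomial_repr (hbθ j)
  obtain ⟨U, V, D, hD, hUV⟩ := exists_separability_certificate hθ
  -- the common denominator `S = ∏ s j` and the point `c`
  have hS : (∏ j, s j : (MvPolynomial σ F)) ≠ 0 := Finset.prod_ne_zero_iff.mpr fun j _ => hs j
  obtain ⟨c, hc⟩ := exists_eval_ne_zero (mul_ne_zero hD hS)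
  rw [map_mul, mul_ne_zero_iff] at hc
  -- the power-series root `Θ` of `P(X + c, ·)`
  obtain ⟨Θ, hΘ⟩ := exists_powerSeries_root (minpoly.monic hθ) (minpoly.natDegree_pos hθ) hUV hc.1
  -- `B = A[1/S]` and its maps to `K̄` and to `F⟦X⟧`
  have hunitK :
      IsUnit (algebraMap (MvPolynomial σ F) (FractionRing (MvPolynomial σ F)) (∏ j, s j)) :=
    isUnit_iff_ne_zero.mpr ((map_ne_zero_iff _
      (IsFractionRing.injective (MvPolynomial σ F) (FractionRing (MvPolynomial σ F)))).mpr hS)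
  let fΩ : Localization.Away (∏ j, s j) →+* (AlgebraicClosure (FractionRing (MvPolynomial σ F))) :=
    (algebraMap (FractionRing (MvPolynomial σ F))
        (AlgebraicClosure (FractionRing (MvPolynomial σ F)))).comp
      (IsLocalization.Away.lift (∏ j, s j) hunitK)
  have hfΩ : fΩ.comp (algebraMap (MvPolynomial σ F) (Localization.Away (∏ j, s j))) =
      algebraMap (MvPolynomial σ F) (AlgebraicClosure (FractionRing (MvPolynomial σ F))) := by
    rw [RingHom.comp_assoc, IsLocalization.Away.lift_comp, ← IsScalarTower.algebraMap_eq]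
  have hfΩ' : ∀ a, fΩ (algebraMap (MvPolynomial σ F) (Localization.Away (∏ j, s j)) a) =
      algebraMap (MvPolynomial σ F) (AlgebraicClosure (FractionRing (MvPolynomial σ F))) a :=
    fun a => RingHom.congr_fun hfΩ a
  let fP : Localization.Away (∏ j, s j) →+* (MvPowerSeries σ F) :=
    IsLocalization.Away.lift (∏ j, s j) (isUnit_shift c hc.2)
  have hfP : fP.comp (algebraMap (MvPolynomial σ F) (Localization.Away (∏ j, s j))) = shift c :=
    IsLocalization.Away.lift_comp _ _
  have hfP' : ∀ a,
      fP (algebraMap (MvPolynomial σ F) (Localization.Away (∏ j, s j)) a) = shift c a :=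
    fun a => RingHom.congr_fun hfP a
  -- `q j = S⁻¹ · (∏_{j' ≠ j} s j') · Q j ∈ B[X]`, with `q j (θ) = b j`
  let q : τ → (Localization.Away (∏ j, s j))[X] := fun j =>
    Polynomial.C (IsLocalization.Away.invSelf (∏ j, s j) *
        algebraMap (MvPolynomial σ F) (Localization.Away (∏ j, s j))
          (∏ j' ∈ Finset.univ.erase j, s j')) *
      (Q j).map (algebraMap (MvPolynomial σ F) (Localization.Away (∏ j, s j)))
  have hq : ∀ j, (q j).eval₂ fΩ θ = b j := by
    intro j
    simp only [q, Polynomial.eval₂_mul, Polynomial.eval₂_C, Polynomial.eval₂_map, hfΩ, map_mul]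
    rw [← Polynomial.aeval_def, hQ j, hfΩ', ← mul_assoc, mul_assoc (fΩ _), ← map_mul,
      Finset.prod_erase_mul _ _ (Finset.mem_univ j), ← hfΩ', ← map_mul,
      mul_comm (IsLocalization.Away.invSelf _), IsLocalization.Away.mul_invSelf, map_one, one_mul]
  -- the substitution `z ↦ z`, `y ↦ q` : `F[z, y] → B[X]`
  let ιB : F →+* (Localization.Away (∏ j, s j))[X] :=
    Polynomial.C.comp
      ((algebraMap (MvPolynomial σ F) (Localization.Away (∏ j, s j))).comp MvPolynomial.C)
  let pt : σ ⊕ τ → (Localization.Away (∏ j, s j))[X] :=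
    Sum.elim (fun v => Polynomial.C (algebraMap (MvPolynomial σ F) (Localization.Away (∏ j, s j))
      (MvPolynomial.X v))) q
  refine ⟨c, fun j => (q j).eval₂ fP Θ, fun G hG => ?_⟩
  -- `G̃ = G(z, q)` vanishes at `θ` ...
  have hGθ : (MvPolynomial.eval₂ ιB pt G).eval₂ fΩ θ = 0 := by
    rw [← Polynomial.coe_eval₂RingHom, MvPolynomial.eval₂_comp_left, ← hG, MvPolynomial.aeval_def]
    have hcomp : (Polynomial.eval₂RingHom fΩ θ).comp ιB =
        algebraMap F (AlgebraicClosure (FractionRing (MvPolynomial σ F))) := by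
      ext a
      simp only [ιB, RingHom.comp_apply, Polynomial.coe_eval₂RingHom, Polynomial.eval₂_C, hfΩ']
      rw [IsScalarTower.algebraMap_apply F (MvPolynomial σ F)
          (AlgebraicClosure (FractionRing (MvPolynomial σ F))), MvPolynomial.algebraMap_eq]
    rw [hcomp]
    congr 1
    funext x
    rcases x with v | j
    · simp [pt, hfΩ']
    · simpa [pt] using hq j
  -- ... hence at `Θ`
  have h0 := eval₂_eq_zero_of_isLocalization hθ hΘ hc.2 hfΩ hfP hGθ
  rw [← Polynomial.coe_eval₂RingHom, MvPolynomial.eval₂_comp_left] at h0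
  have hcomp : (Polynomial.eval₂RingHom fP Θ).comp ιB = algebraMap F (MvPowerSeries σ F) := by
    ext a
    simp only [ιB, RingHom.comp_apply, Polynomial.coe_eval₂RingHom, Polynomial.eval₂_C, hfP',
      shift_C, MvPowerSeries.algebraMap_apply, Algebra.algebraMap_self, RingHom.id_apply]
  rw [hcomp] at h0
  rw [MvPolynomial.aeval_def, ← h0]
  congr 1
  funext x
  rcases x with v | j
  · simp [pt, hfP']
  · simp [pt]

/-- **Garg–Makam–Oliveira–Wigderson 2019, Theorem 1.21 (numeric to symbolic transfer), proved.**
Let `F` be an algebraically closed field of characteristic zero and `L : F^σ → F^ι`,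
`M : F^τ → F^ι` polynomial maps (`σ, τ, ι` finite) such that `im(L) ⊆ im(M)`. Then there exist
`c ∈ F^σ` and power series `p₁, …, p_τ ∈ F⟦X_σ⟧` such that `L(X + c) = M(p₁, …, p_τ)`:
for every `i`, `Mᵢ(p) = Lᵢ(X + c)` as power series.
[cite: GargMakamOliveiraWigderson2019, Thm. 1.21] -/
theorem numericToSymbolic [IsAlgClosed F] [CharZero F] [Finite σ] {τ ι : Type*} [Finite τ]
    [Finite ι] (L : ι → MvPolynomial σ F) (M : ι → MvPolynomial τ F) (hLM : ImageSubset L M) :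
    ∃ (c : σ → F) (p : τ → MvPowerSeries σ F), ∀ i,
      MvPolynomial.eval₂ MvPowerSeries.C p (M i) = shift c (L i) := by
  classical
  -- Prop. 3.3: a solution `b` algebraic over `K`; Prop. 3.4: transfer to power series
  obtain ⟨b, hb⟩ := exists_generic_solution L M hLM
  obtain ⟨c, p, hcp⟩ := exists_powerSeries_transfer (F := F) b
  refine ⟨c, p, fun i => ?_⟩
  have hz : MvPolynomial.aeval (fun v => algebraMap (MvPolynomial σ F)
      (AlgebraicClosure (FractionRing (MvPolynomial σ F))) (MvPolynomial.X v)) (L i) =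
      algebraMap (MvPolynomial σ F) (AlgebraicClosure (FractionRing (MvPolynomial σ F))) (L i) := by
    have h2 := congrArg (fun f => f (L i))
      (MvPolynomial.aeval_unique (IsScalarTower.toAlgHom F (MvPolynomial σ F)
        (AlgebraicClosure (FractionRing (MvPolynomial σ F)))))
    simpa [Function.comp_def] using h2.symm
  have key := hcp (MvPolynomial.rename Sum.inr (M i) - MvPolynomial.rename Sum.inl (L i)) (by
    rw [map_sub, MvPolynomial.aeval_rename, MvPolynomial.aeval_rename, sub_eq_zero,
      Sum.elim_comp_inl, Sum.elim_comp_inr, hb i, hz])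
  rw [map_sub, MvPolynomial.aeval_rename, MvPolynomial.aeval_rename, sub_eq_zero,
    Sum.elim_comp_inl, Sum.elim_comp_inr, MvPolynomial.aeval_def, MvPolynomial.aeval_def,
    ← MvPowerSeries.c_eq_algebraMap] at key
  rw [key]
  rfl

end Literature.RingTheory.PolynomialMaps
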